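import Summits.AtomisticToContinuum.Crystallization.Theorems.RepetitiveNetworkReductionRecurrentMemberDefs

/-!
# FrustratedLawDichotomy · crux `AperiodicFrustratedLawGap` (stmt-AtomisticToContinuum-27623) — UNIFORM-VERDICT BALLS ARE UNTEXTURED (pure logic on `TexBall`)
# (decomp-a2c hand-2 g45, STRUCTURAL share #57: DEF-FREE; critic r1702 (B)(3) layer (UV) of `not_coherent_of_texBall`)

The E′ texture door (`…SignedLedgerTextureDoor`) asks for the incompatibility «texture ⟹ some atom is incoherent».  Its first layer is PURE
LOGIC on the crux's texture predicate `TexBall N y i R R₇ R₈ R₉` (named form, verbatim the route's `let`: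
`…RepetitiveNetworkReductionRecurrentMember.TexBall` over `Gy`), with NO geometry: a textured ball never has a UNIFORM `1/8`-verdict —

* `exists_good_near_of_texBall` — clause 4 at the centre: some site within `R₈` of the centre IS `1/8`-good (`0 ≤ R`); hence
  `not_forall_bad_of_texBall` — not every site within `R₈` (or within any `ρ ≥ R₈`) of the centre is `1/8`-bad;
* ★ `not_forall_good_of_texBall` — clauses 2 + 5 at the centre: not every site within `R₉` of the centre is `1/8`-good (`0 ≤ R`, `R₉ ≤ R`): if all
  were, the `R₉`-ball about the centre would be all-`1/20`-bad (clause 2, `R₉ ≤ R`) with ZERO `1/8`-bad sites (`≤ ½` of anything) and a vacuous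
  third conjunct — exactly what clause 5 forbids; hence `not_forall_good_of_texBall_of_le` for any radius `ρ ≥ R₉`;
* ★ `not_uniformVerdict_of_texBall` — both together: on the `ρ`-ball about the centre, `max R₈ R₉ ≤ ρ`, the `1/8`-verdict is NOT constant.

The second layer (FLIP: an `(L, τ₀)`-coherent ball off the `1/8`-collar has a uniform verdict) is geometry, owed by lens-5 g111 (r1702 (B)(3)(b)).
Tags: [folklore: logic].
-/

noncomputable section

namespace Summit.AtomisticToContinuum.Crystallization.Theorems.FrustratedLawDichotomyTextureUniformVerdict

open Summit.AtomisticToContinuum.Crystallization.Theorems.RepetitiveNetworkReductionRecurrentMember (Gy TexBall)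

variable {N : ℕ} {y : Fin N → EuclideanSpace ℝ (Fin 3)} {i : Fin N} {R R₇ R₈ R₉ : ℝ}

/-- **Clause 4 at the centre**: a textured ball has a `1/8`-GOOD site within `R₈` of its centre (`0 ≤ R`). [folklore: logic] -/
theorem exists_good_near_of_texBall (h : TexBall N y i R R₇ R₈ R₉) (hR : 0 ≤ R) :
    ∃ k : Fin N, dist (y k) (y i) ≤ R₈ ∧ Gy (1 / 8) N y k := by
  obtain ⟨-, -, -, h4, -⟩ := h
  exact h4 i (by rw [dist_self]; exact hR)

/-- **Not all bad near the centre**: for any radius `ρ ≥ R₈`, not every site within `ρ` of the centre of a textured ball is `1/8`-bad (`0 ≤ R`).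
[folklore: logic] -/
theorem not_forall_bad_of_texBall (h : TexBall N y i R R₇ R₈ R₉) (hR : 0 ≤ R) {ρ : ℝ} (hρ : R₈ ≤ ρ) :
    ¬ ∀ j : Fin N, dist (y j) (y i) ≤ ρ → ¬ Gy (1 / 8) N y j := by
  intro hall
  obtain ⟨k, hk, hgood⟩ := exists_good_near_of_texBall h hR
  exact hall k (hk.trans hρ) hgood

/-- ★ **Not all good near the centre**: not every site within `R₉` of the centre of a textured ball is `1/8`-good (`0 ≤ R`, `R₉ ≤ R`) —
clause 5 at the centre forbids an all-`1/20`-bad `R₉`-ball with at most half of its sites `1/8`-bad and no `5`-ring obstruction at `1/8`-bad sites;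
under «all `1/8`-good» the first conjunct is clause 2 (`R₉ ≤ R`), the second reads `0 ≤ ½·#ball`, the third is vacuous. [folklore: logic] -/
theorem not_forall_good_of_texBall (h : TexBall N y i R R₇ R₈ R₉) (hR : 0 ≤ R) (hR₉ : R₉ ≤ R) :
    ¬ ∀ j : Fin N, dist (y j) (y i) ≤ R₉ → Gy (1 / 8) N y j := by
  intro hall
  obtain ⟨-, h2, -, -, h5⟩ := h
  refine h5 i (by rw [dist_self]; exact hR) ⟨?_, ?_, ?_⟩
  · intro j' hj'
    exact h2 j' (hj'.trans hR₉)
  · have hempty : IsEmpty {j' : Fin N // dist (y j') (y i) ≤ R₉ ∧ ¬ Gy (1 / 8) N y j'} :=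
      ⟨fun j' => j'.2.2 (hall j'.1 j'.2.1)⟩
    rw [Nat.card_of_isEmpty, Nat.cast_zero]
    positivity
  · intro j' hj' hbad
    exact absurd (hall j' hj') hbad

/-- **Not all good, any radius `ρ ≥ R₉`** (`0 ≤ R`, `R₉ ≤ R`). [folklore: logic] -/
theorem not_forall_good_of_texBall_of_le (h : TexBall N y i R R₇ R₈ R₉) (hR : 0 ≤ R) (hR₉ : R₉ ≤ R) {ρ : ℝ} (hρ : R₉ ≤ ρ) :
    ¬ ∀ j : Fin N, dist (y j) (y i) ≤ ρ → Gy (1 / 8) N y j :=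
  fun hall => not_forall_good_of_texBall h hR hR₉ fun j hj => hall j (hj.trans hρ)

/-- ★ **UNIFORM-VERDICT BALLS ARE UNTEXTURED.**  On the `ρ`-ball about the centre of a textured ball (`0 ≤ R`, `R₉ ≤ R`, `R₈ ≤ ρ`, `R₉ ≤ ρ`) the
`1/8`-verdict `Gy (1/8)` is NOT constant: neither all sites are `1/8`-good nor all are `1/8`-bad.  (Layer (UV) of `not_coherent_of_texBall`,
critic r1702 (B)(3); the geometric layer (FLIP) supplies the uniform verdict on coherent balls off the collar.) [folklore: logic] -/
theorem not_uniformVerdict_of_texBall (h : TexBall N y i R R₇ R₈ R₉) (hR : 0 ≤ R) (hR₉ : R₉ ≤ R) {ρ : ℝ} (hρ₈ : R₈ ≤ ρ)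
    (hρ₉ : R₉ ≤ ρ) :
    (¬ ∀ j : Fin N, dist (y j) (y i) ≤ ρ → Gy (1 / 8) N y j) ∧
      ¬ ∀ j : Fin N, dist (y j) (y i) ≤ ρ → ¬ Gy (1 / 8) N y j :=
  ⟨not_forall_good_of_texBall_of_le h hR hR₉ hρ₉, not_forall_bad_of_texBall h hR hρ₈⟩

/-- **The verdict function is not constant** (Bool form): there is no `b` with `Gy (1/8) N y j ↔ b` for every site `j` of the `ρ`-ball.
[folklore: logic] -/
theorem not_exists_constVerdict_of_texBall (h : TexBall N y i R R₇ R₈ R₉) (hR : 0 ≤ R) (hR₉ : R₉ ≤ R) {ρ : ℝ} (hρ₈ : R₈ ≤ ρ)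
    (hρ₉ : R₉ ≤ ρ) :
    ¬ ∃ b : Prop, ∀ j : Fin N, dist (y j) (y i) ≤ ρ → (Gy (1 / 8) N y j ↔ b) := by
  rintro ⟨b, hb⟩
  obtain ⟨hng, hnb⟩ := not_uniformVerdict_of_texBall h hR hR₉ hρ₈ hρ₉
  by_cases hbv : b
  · exact hng fun j hj => (hb j hj).mpr hbv
  · exact hnb fun j hj hg => hbv ((hb j hj).mp hg)

end Summit.AtomisticToContinuum.Crystallization.Theorems.FrustratedLawDichotomyTextureUniformVerdict

end
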